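import Mathlib
import Literature.Analysis.PDE.NearInverseSquareFarAbsorb
import Literature.Analysis.PDE.Wave1DSpatialReflection

/-!
# The unit-scale far channel estimate from a true non-radiating kernel family

Analysis/PDE support file (everything proved). `unitFarChannel_of_kernelFamily` derives the
UNIT-SCALE far channel inequality `UNIT(n)` of route PhotonSphereChannels
(`Theorems.fixedModeChannels_of_unitFarChannel`; verbatim `let`-form: energy density with
`deriv`, `IsSol` with `iteratedDeriv 2`, cone `{x > 1 + |t|}`, kernel `P₁` of `C²` `t`-polynomial
solutions on the cone, `lintegral` exterior energies, `liminf` at `±∞`, `⨅ p ∈ P₁`) for potentials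
`W ≥ 0` with `|W − n(n+1)/x²| ≤ ε x^{−5/2}` (`x ≥ ½`), from the EXISTENCE OF A TRUE KERNEL FAMILY:
for some `ε_K > 0` and every such `ε_K`-close `W`, finitely many non-radiating far solutions
`B_m` (global `C²`, residual `0` on `{x ≥ 1}`, finite `W`-energy, far energies `→ 0` at `±∞`,
`t`-polynomial on the unit cone) whose combinations approximate every exact kernel datum to
relative accuracy `½` in the `W`-energy norm (hypothesis `happroxK` of
`NearInverseSquareFarAbsorb.farUnit_absorb`). Proof: kernel absorption
(`farUnit_absorb`, constant `144/c₀(n)`) for finite-energy solutions, the combination being an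
element of `P₁` (`Wave1DFarLincomb`); infinite-energy solutions have infinite channel energies
(`Wave1DSpatialReflection.wave1D_farEnergy_eq_top_of_initial_eq_top`); `ENNReal` bookkeeping.
Item `FixedModeChannels`, far side (stmt-FinalStateConjecture-10048).
-/

noncomputable section

namespace Literature.Analysis.PDE

open Set Filter MeasureTheory Finset Literature.Analysis.ODE
open scoped _root_.Topology _root_.ENNReal

variable {ι : ℝ → ℝ}

/-- **`UNIT(n)` from a true kernel family.** See the module docstring. [folklore] -/
theorem unitFarChannel_of_kernelFamily (hι : ContDiff ℝ (⊤ : ℕ∞) ι)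
    (hιeq : ∀ x : ℝ, 1 / 2 ≤ x → ι x = x⁻¹) {I : ℝ → ℝ} (hI : ContDiff ℝ (⊤ : ℕ∞) I)
    (hI' : ∀ x, HasDerivAt I (ι x) x) (n : ℕ)
    (hK : ∃ εK : ℝ, 0 < εK ∧ ∀ (W : ℝ → ℝ), Continuous W → (∀ x, 0 ≤ W x) →
      (∀ x : ℝ, 1 / 2 ≤ x → |W x - (n : ℝ) * ((n : ℝ) + 1) / x ^ 2| ≤ εK * x ^ (-(5 : ℝ) / 2)) →
      ∃ (M : ℕ) (B : Fin M → ℝ → ℝ → ℝ), (∀ m, ContDiff ℝ 2 (Function.uncurry (B m))) ∧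
      (∀ m t x, 1 ≤ x →
        iteratedDeriv 2 (fun τ => B m τ x) t - iteratedDeriv 2 (B m t) x + W x * B m t x = 0) ∧
      (∀ m, IntegrableOn (fun x => deriv (fun τ => B m τ x) 0 ^ 2 + deriv (B m 0) x ^ 2
        + W x * B m 0 x ^ 2) (Ioi 1)) ∧
      (∀ m, Tendsto (fun t => ∫ x in Ioi (1 + |t|), (deriv (fun τ => B m τ x) t ^ 2
        + deriv (B m t) x ^ 2 + W x * B m t x ^ 2)) atTop (𝓝 0)) ∧
      (∀ m, Tendsto (fun t => ∫ x in Ioi (1 + |t|), (deriv (fun τ => B m τ x) t ^ 2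
        + deriv (B m t) x ^ 2 + W x * B m t x ^ 2)) atBot (𝓝 0)) ∧
      (∀ m, ∃ (N : ℕ) (a : ℕ → ℝ → ℝ), ∀ z : ℝ × ℝ, 1 + |z.1| < z.2 →
        B m z.1 z.2 = ∑ i ∈ Finset.range N, a i z.2 * z.1 ^ i) ∧
      (∀ (ch cg : ℕ → ℝ) (ε' : ℝ), 0 < ε' → ∃ c : Fin M → ℝ,
        Real.sqrt (∫ x in Ioi 1,
          (deriv (fun y => ladder ι n (fun z => ∑ m ∈ Finset.range (n + 1),
              ch m / m.factorial * (z - 1) ^ m) y - ∑ m, c m * B m 0 y) x ^ 2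
          + W x * (ladder ι n (fun z => ∑ m ∈ Finset.range (n + 1),
              ch m / m.factorial * (z - 1) ^ m) x - ∑ m, c m * B m 0 x) ^ 2
          + (ladder ι n (fun z => ∑ m ∈ Finset.range n, cg m / m.factorial * (z - 1) ^ m) x
              - ∑ m, c m * deriv (fun τ => B m τ x) 0) ^ 2))
        ≤ (1 / 2) * Real.sqrt (∫ x in Ioi 1,
          (deriv (ladder ι n (fun z => ∑ m ∈ Finset.range (n + 1),
              ch m / m.factorial * (z - 1) ^ m)) x ^ 2
          + W x * (ladder ι n (fun z => ∑ m ∈ Finset.range (n + 1),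
              ch m / m.factorial * (z - 1) ^ m) x) ^ 2
          + (ladder ι n (fun z => ∑ m ∈ Finset.range n, cg m / m.factorial * (z - 1) ^ m) x) ^ 2))
          + ε')) :
    ∃ ε : ℝ, 0 < ε ∧ ∃ c : ℝ, 0 < c ∧ ∀ W : ℝ → ℝ, Continuous W → (∀ y, 0 ≤ W y) →
      (∀ y : ℝ, 1 / 2 ≤ y → |W y - (n : ℝ) * ((n : ℝ) + 1) / y ^ 2| ≤ ε * y ^ (-(5 : ℝ) / 2)) →
      ∀ φ : ℝ → ℝ → ℝ, ContDiff ℝ 2 (Function.uncurry φ) →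
      (∀ t y, iteratedDeriv 2 (fun τ => φ τ y) t - iteratedDeriv 2 (φ t) y + W y * φ t y = 0) →
      let e₁ : (ℝ → ℝ → ℝ) → ℝ → ℝ → ℝ := fun φ t x =>
        deriv (fun τ => φ τ x) t ^ 2 + deriv (φ t) x ^ 2 + W x * φ t x ^ 2
      let IsSol₁ : (ℝ → ℝ → ℝ) → ℝ × ℝ → Prop := fun φ z =>
        iteratedDeriv 2 (fun τ => φ τ z.2) z.1 - iteratedDeriv 2 (φ z.1) z.2 + W z.2 * φ z.1 z.2 = 0
      let Ω₁ : Set (ℝ × ℝ) := {z | 1 + |z.1| < z.2}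
      let P₁ : Set (ℝ → ℝ → ℝ) := {p | ContDiffOn ℝ 2 (Function.uncurry p) Ω₁ ∧
        (∀ z ∈ Ω₁, IsSol₁ p z) ∧ ∃ (N : ℕ) (a : ℕ → ℝ → ℝ), ∀ z ∈ Ω₁,
          p z.1 z.2 = ∑ i ∈ Finset.range N, a i z.2 * z.1 ^ i}
      let E₁ : ℝ → ℝ≥0∞ := fun t => ∫⁻ x in Ioi (1 + |t|), ENNReal.ofReal (e₁ φ t x)
      ENNReal.ofReal c * (⨅ p ∈ P₁, ∫⁻ x in Ioi 1,
          ENNReal.ofReal (e₁ (fun t y => φ t y - p t y) 0 x))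
        ≤ liminf E₁ atTop + liminf E₁ atBot := by
  obtain ⟨c₀, hc₀, habs⟩ := farUnit_absorb hι hιeq hI hI' n
  obtain ⟨εK, hεK, hfam⟩ := hK
  set ε : ℝ := min εK (min (1 / 4) (c₀ / 9216)) with hε
  have hε0 : 0 < ε := lt_min hεK (lt_min (by norm_num) (by positivity))
  have hεK' : ε ≤ εK := min_le_left _ _
  have hεle : ε ≤ min (1 / 4) (c₀ / 9216) := min_le_right _ _
  refine ⟨ε, hε0, c₀ / 144, by positivity, ?_⟩
  intro W hW hW0 hclose φ hφ hsol e₁ IsSol₁ Ω₁ P₁ E₁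
  have hcloseK : ∀ y : ℝ, 1 / 2 ≤ y → |W y - (n : ℝ) * ((n : ℝ) + 1) / y ^ 2| ≤ εK * y ^ (-(5 : ℝ) / 2) :=
    fun y hy => (hclose y hy).trans (mul_le_mul_of_nonneg_right hεK' (Real.rpow_nonneg (by linarith) _))
  obtain ⟨M, B, hB, hresB, hintB, hradT, hradB, hpolyB, happroxK⟩ := hfam W hW hW0 hcloseK
  -- the energy density of `φ` at `t = 0`
  have hdens_c : Continuous fun x => deriv (fun τ => φ τ x) 0 ^ 2 + deriv (φ 0) x ^ 2 + W x * φ 0 x ^ 2 :=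
    (continuous_wave1D_energyDensity hW hφ).comp (continuous_const.prodMk continuous_id)
  have hdens_nn : ∀ x, 0 ≤ deriv (fun τ => φ τ x) 0 ^ 2 + deriv (φ 0) x ^ 2 + W x * φ 0 x ^ 2 :=
    fun x => wave1D_energyDensity_nonneg hW0 0 x
  rcases eq_or_lt_of_le (le_top : (∫⁻ x in Ioi 1, ENNReal.ofReal (deriv (fun τ => φ τ x) 0 ^ 2
    + deriv (φ 0) x ^ 2 + W x * φ 0 x ^ 2)) ≤ ⊤) with htop | hfin
  · ----------------------------------------------------------------
    -- infinite energy: every channel energy is infinite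
    ----------------------------------------------------------------
    have hEt : ∀ t, E₁ t = ⊤ := fun t => by
      have h := wave1D_farEnergy_eq_top_of_initial_eq_top hW hW0 hφ hsol (a := 1) htop t
      exact h
    have hlim : liminf E₁ atTop = ⊤ := by
      rw [show E₁ = fun _ => ⊤ from funext hEt]; exact liminf_const ⊤
    calc ENNReal.ofReal (c₀ / 144) * (⨅ p ∈ P₁, ∫⁻ x in Ioi 1,
          ENNReal.ofReal (e₁ (fun t y => φ t y - p t y) 0 x)) ≤ ⊤ := le_top
      _ = liminf E₁ atTop + liminf E₁ atBot := by rw [hlim, top_add]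
  · ----------------------------------------------------------------
    -- finite energy: kernel absorption
    ----------------------------------------------------------------
    obtain ⟨hint, hconv⟩ := integrableOn_Ioi_of_lintegral_lt_top hdens_c hdens_nn hfin
    have hres : ∀ t x, (1 : ℝ) ≤ x →
        iteratedDeriv 2 (fun τ => φ τ x) t - iteratedDeriv 2 (φ t) x + W x * φ t x = 0 :=
      fun t x _ => hsol t x
    -- the far channel limits of `φ`
    obtain ⟨-, hEφ, hTp, hTm, hLp0, hLm0⟩ := farSol_energy hW hW0 hφ hres hint
    set Lp : ℝ := limUnder atTop (fun t => ∫ x in Ioi (1 + |t|),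
      (deriv (fun τ => φ τ x) t ^ 2 + deriv (φ t) x ^ 2 + W x * φ t x ^ 2)) with hLp
    set Lm : ℝ := limUnder atBot (fun t => ∫ x in Ioi (1 + |t|),
      (deriv (fun τ => φ τ x) t ^ 2 + deriv (φ t) x ^ 2 + W x * φ t x ^ 2)) with hLm
    have hlimTop : liminf E₁ atTop = ENNReal.ofReal Lp := by
      refine Tendsto.liminf_eq ?_
      have h := ENNReal.tendsto_ofReal hTp
      refine h.congr fun t => ?_
      exact (hEφ t).2
    have hlimBot : liminf E₁ atBot = ENNReal.ofReal Lm := by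
      refine Tendsto.liminf_eq ?_
      have h := ENNReal.tendsto_ofReal hTm
      refine h.congr fun t => ?_
      exact (hEφ t).2
    rw [hlimTop, hlimBot, ← ENNReal.ofReal_add hLp0 hLm0]
    refine ENNReal.le_of_forall_pos_le_add fun δ hδ _ => ?_
    -- absorption with slack `δ' = 144 δ / c₀ · …`: choose `ε' = δ · 144 / c₀`? we use `ε' = δ * (144 / c₀)`
    have hδ' : (0 : ℝ) < (δ : ℝ) * (144 / c₀) := by positivity
    obtain ⟨c, hintc, hle⟩ := habs ε hε0 hεle W hW hW0 hclose M B hB hresB hintB hradT hradB happroxK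
      φ hφ hres hint ((δ : ℝ) * (144 / c₀)) hδ'
    -- the combination is a kernel element on the unit cone
    set p : ℝ → ℝ → ℝ := fun t x => ∑ m, c m * B m t x with hp
    obtain ⟨hpC, hpres, -⟩ := farSol_lincomb hW hW0 hB hresB hintB c
    have hpP : p ∈ P₁ := by
      refine ⟨hpC.contDiffOn, fun z hz => ?_, ?_⟩
      · have hz' : 1 + |z.1| < z.2 := hz
        exact hpres z.1 z.2 (by linarith [abs_nonneg z.1])
      · obtain ⟨N, a, ha⟩ := tPolynomial_lincomb hpolyB c Finset.univ
        exact ⟨N, a, fun z hz => ha z hz⟩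
    -- the reduced energy of `p`
    have hinf_le : (⨅ q ∈ P₁, ∫⁻ x in Ioi 1, ENNReal.ofReal (e₁ (fun t y => φ t y - q t y) 0 x))
        ≤ ENNReal.ofReal (∫ x in Ioi 1, (deriv (fun τ => φ τ x - ∑ m, c m * B m τ x) 0 ^ 2
          + deriv (fun y => φ 0 y - ∑ m, c m * B m 0 y) x ^ 2
          + W x * (φ 0 x - ∑ m, c m * B m 0 x) ^ 2)) := by
      refine (iInf₂_le p hpP).trans (le_of_eq ?_)
      rw [ofReal_integral_eq_lintegral_ofReal hintc (ae_of_all _ fun x =>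
        wave1D_energyDensity_nonneg (ψ := fun t x => φ t x - ∑ m, c m * B m t x) hW0 0 x)]
    calc ENNReal.ofReal (c₀ / 144) * (⨅ q ∈ P₁, ∫⁻ x in Ioi 1,
          ENNReal.ofReal (e₁ (fun t y => φ t y - q t y) 0 x))
        ≤ ENNReal.ofReal (c₀ / 144) * ENNReal.ofReal (∫ x in Ioi 1,
            (deriv (fun τ => φ τ x - ∑ m, c m * B m τ x) 0 ^ 2
            + deriv (fun y => φ 0 y - ∑ m, c m * B m 0 y) x ^ 2
            + W x * (φ 0 x - ∑ m, c m * B m 0 x) ^ 2)) := by gcongr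
      _ = ENNReal.ofReal ((c₀ / 144) * ∫ x in Ioi 1,
            (deriv (fun τ => φ τ x - ∑ m, c m * B m τ x) 0 ^ 2
            + deriv (fun y => φ 0 y - ∑ m, c m * B m 0 y) x ^ 2
            + W x * (φ 0 x - ∑ m, c m * B m 0 x) ^ 2)) := (ENNReal.ofReal_mul (by positivity)).symm
      _ ≤ ENNReal.ofReal ((Lp + Lm) + δ) := by
          refine ENNReal.ofReal_le_ofReal ?_
          have h1 := mul_le_mul_of_nonneg_left hle (by positivity : (0 : ℝ) ≤ c₀ / 144)
          have e : (c₀ / 144) * ((144 / c₀) * (Lp + Lm) + (δ : ℝ) * (144 / c₀)) = (Lp + Lm) + δ := by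
            field_simp
          linarith
      _ = ENNReal.ofReal (Lp + Lm) + (δ : ℝ≥0∞) := by
          rw [ENNReal.ofReal_add (add_nonneg hLp0 hLm0) (NNReal.coe_nonneg δ), ENNReal.ofReal_coe_nnreal]

end Literature.Analysis.PDE
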